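import Literature.NumberTheory.Sieve.IwaniecAlmostPrimesRootExpSum
import Literature.NumberTheory.Sieve.IwaniecAlmostPrimesRhoMeanValue
import HarnessLib

/-!
# Iwaniec (1978), Lemma 4 (corrected): equidistribution of `Ω/(qm)` in windows — PROVED from Lemma 6

H. Iwaniec, *Almost-primes represented by quadratic polynomials*, Invent. Math. **47** (1978)
171–188, Lemma 4 (p. 177): "Let `q` be a squarefree number, `d` — an odd divisor of `q`,
`(d, μ) = 1` and `ω² + 1 ≡ 0 (mod d)`.  Moreover let `1 ≤ M < M₁ < 2M` and `0 ≤ α < β < 1`.  We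
denote by `P(M₁, M; q, d, μ, ω, α, β)` the number of pairs of integers `m, Ω` such that
`M < m < M₁`, `(m, q) = 1`, `m ≡ μ (mod d)`, `αmq ≤ Ω < βmq`, `Ω² + 1 ≡ 0 (mod mq)`,
`Ω ≡ ω (mod d)`.  For any `ε > 0` we have
`P = (π/4)(β − α)(M₁ − M) ρ(q/d) A(q)/φ(d) + O((qM)^{3/4+ε})`."  As recorded in
`IwaniecAlmostPrimes.lean` the printed MAIN TERM is too large by `π²/6`; what the dispersion
argument (pp. 181–185) really uses is the RELATIVE statement — the pairs are equidistributed in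
`Θ/(mq)` against their total number `P(0, 1)`, which in turn is `ρ(q/d)` times the mean value of
`ρ` (the corrected main term, `IwaniecAlmostPrimesRhoMeanValue.lean`).  Third file of the inline
proof of Proposition 1 (`Literature.NumberTheory.Sieve.Iwaniec1978.proposition1`); everything
here is PROVED from the hypothesis `lemma6_hooley` (itself discharged in
`IwaniecAlmostPrimesProofs.lean`), no named facts are introduced.

* `lemma4_window` — **Lemma 4, relative form**: for `ε > 0` there is `C` with
  `|P(α, β) − (β − α) P(0, 1)| ≤ 4 P(0,1)/A^{1/4} + C d (∑_{l∣Q} ρ(lq)) (1 + log 16A)² S^{1/2+ε} S`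
  (`S = ⌊√(Bq)⌋`) for the family `lemma4Family q Q d μ ω A B` (`A < m ≤ B`, `(m, Q) = 1`,
  `m ≡ μ (d)`, `Θ` root mod `mq`, `Θ ≡ ω (d)`), all `Q ≠ 0`, `q ≥ 1`, `d ∣ q`, `A ≥ 2`,
  `0 ≤ α ≤ β ≤ 1`: the Fejér-kernel form of Erdős–Turán (`FejerCounting.card_filter_fract_lt_le`,
  `le_card_filter_fract_lt`, replacing the paper's Lemma 7) with `H = ⌊√A⌋ + 15`,
  `δ = (H+1)^{-1/2}`, the exponential sums from `norm_rootExpSum_le`, and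
  `∑_{h ≤ H} τ(h)/h ≤ (1 + log H)²` (`sum_card_divisors_div_le`);
* `card_rootsNat_filter_modEq` (CRT: roots mod `nd` in the class of a root `ω` mod `d` number
  `ρ(n)`), `card_lemma4Family_eq` — **the total count**
  `P(0, 1) = ρ(q/d) (Σ₀(B; Q, d, μ) − Σ₀(A; Q, d, μ))`, `Σ₀ = rhoSumAP`, for `Q` squarefree,
  `q ∣ Q`, `d ∣ q`, `d ∣ ω² + 1`.

With `abs_rhoSumAP_sub_le` this gives `P(α, β) = (β − α) ρ(q/d)(κ/φ(d))(B − A) + (errors)` with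
Iwaniec's `(qM)^{3/4+ε}`-type error, which is how the evaluations of `V` and `W` consume it.

## References

* H. Iwaniec, Invent. Math. 47 (1978) 171–188, Lemmas 4–7, §4 (`IwaniecInventiones1978`).
* P. Erdős, P. Turán, Indag. Math. 10 (1948) (via `FejerKernelCounting.lean`).
-/

noncomputable section

open Finset Real
open scoped FourierTransform

namespace Literature.NumberTheory.Sieve.Iwaniec1978

/-! ### Small analytic sums -/

/-- `∑_{h ≤ H} τ(h)/h ≤ (1 + log H)²` (`= ∑_{ab ≤ H} 1/(ab) ≤ (∑_{a ≤ H} 1/a)²`). [folklore] -/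
theorem sum_card_divisors_div_le {H : ℕ} (hH : 1 ≤ H) :
    ∑ h ∈ Finset.Icc 1 H, ((Nat.divisors h).card : ℝ) / h ≤ (1 + Real.log H) ^ 2 := by
  have h1 : ∑ h ∈ Finset.Icc 1 H, ((Nat.divisors h).card : ℝ) / h =
      ∑ h ∈ Finset.Icc 1 H, ∑ q ∈ Nat.divisorsAntidiagonal h, (1 : ℝ) / (q.1 * q.2) := by
    refine Finset.sum_congr rfl fun h hh => ?_
    have : ∀ q ∈ Nat.divisorsAntidiagonal h, (1 : ℝ) / (q.1 * q.2) = 1 / h := by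
      intro q hq
      rw [Nat.mem_divisorsAntidiagonal] at hq
      rw [← hq.1]; push_cast; rfl
    have hcard : (Nat.divisorsAntidiagonal h).card = h.divisors.card := by
      rw [← Nat.map_div_right_divisors, Finset.card_map]
    rw [Finset.sum_congr rfl this, Finset.sum_const, nsmul_eq_mul, hcard]
    ring
  rw [h1, SquarefreeSums.sum_Icc_sum_divisorsAntidiagonal (fun a b => (1 : ℝ) / (a * b)) H]
  have hharm : ∑ a ∈ Finset.Icc 1 H, (1 : ℝ) / a ≤ 1 + Real.log H := by
    have := harmonic_le_one_add_log H
    rw [harmonic_eq_sum_Icc] at this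
    push_cast at this
    simpa [one_div] using this
  have hpos : 0 ≤ ∑ a ∈ Finset.Icc 1 H, (1 : ℝ) / a := Finset.sum_nonneg fun _ _ => by positivity
  have hlog : 0 ≤ 1 + Real.log H := by
    have := Real.log_nonneg (by exact_mod_cast hH : (1 : ℝ) ≤ H); linarith
  calc ∑ a ∈ Finset.Icc 1 H, ∑ b ∈ Finset.Icc 1 (H / a), (1 : ℝ) / (a * b)
      ≤ ∑ a ∈ Finset.Icc 1 H, ∑ b ∈ Finset.Icc 1 H, (1 : ℝ) / (a * b) := by
        refine Finset.sum_le_sum fun a _ => ?_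
        exact Finset.sum_le_sum_of_subset_of_nonneg
          (Finset.Icc_subset_Icc_right (Nat.div_le_self H a)) fun _ _ _ => by positivity
    _ = (∑ a ∈ Finset.Icc 1 H, (1 : ℝ) / a) * (∑ b ∈ Finset.Icc 1 H, (1 : ℝ) / b) := by
        rw [Finset.sum_mul_sum]
        refine Finset.sum_congr rfl fun a _ => Finset.sum_congr rfl fun b _ => ?_
        rw [one_div_mul_one_div]
    _ ≤ (1 + Real.log H) * (1 + Real.log H) := mul_le_mul hharm hharm hpos hlog
    _ = (1 + Real.log H) ^ 2 := by ring

/-- A symmetric sum over `0 < |d| ≤ H` of an even function is twice the sum over `1 ≤ d ≤ H`.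
[folklore] -/
theorem sum_Icc_erase_zero_eq_two_mul (F : ℤ → ℝ) (hF : ∀ d, F (-d) = F d) (H : ℕ) :
    ∑ d ∈ (Finset.Icc (-(H : ℤ)) H).erase 0, F d = 2 * ∑ h ∈ Finset.Icc 1 H, F h := by
  have hsplit : (Finset.Icc (-(H : ℤ)) H).erase 0 =
      (Finset.Icc 1 H).image (fun h : ℕ => (h : ℤ)) ∪
        (Finset.Icc 1 H).image (fun h : ℕ => -(h : ℤ)) := by
    ext d
    simp only [Finset.mem_erase, Finset.mem_Icc, Finset.mem_union, Finset.mem_image]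
    constructor
    · rintro ⟨hd0, h1, h2⟩
      rcases lt_or_gt_of_ne hd0 with hneg | hpos
      · right; exact ⟨d.natAbs, ⟨by omega, by omega⟩, by omega⟩
      · left; exact ⟨d.natAbs, ⟨by omega, by omega⟩, by omega⟩
    · rintro (⟨h, ⟨h1, h2⟩, rfl⟩ | ⟨h, ⟨h1, h2⟩, rfl⟩) <;> exact ⟨by omega, by omega, by omega⟩
  have hdisj : Disjoint ((Finset.Icc 1 H).image (fun h : ℕ => (h : ℤ)))
      ((Finset.Icc 1 H).image (fun h : ℕ => -(h : ℤ))) := by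
    rw [Finset.disjoint_left]
    intro d hd hd'
    rw [Finset.mem_image] at hd hd'
    obtain ⟨a, ha, rfl⟩ := hd
    obtain ⟨b, hb, hab⟩ := hd'
    rw [Finset.mem_Icc] at ha hb
    omega
  rw [hsplit, Finset.sum_union hdisj, Finset.sum_image (fun a _ b _ h => by exact_mod_cast h),
    Finset.sum_image (fun a _ b _ h => by exact_mod_cast neg_inj.mp h)]
  have : ∀ h ∈ Finset.Icc 1 H, F (-(h : ℤ)) = F h := fun h _ => hF h
  rw [Finset.sum_congr rfl this]
  ring

/-! ### Windows and fractional parts -/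

/-- For `x ∈ [0, 1)` and `0 ≤ α ≤ β ≤ 1`: `{x − α} < β − α ⇔ α ≤ x < β`. [folklore] -/
theorem fract_sub_lt_iff {x α β : ℝ} (hx0 : 0 ≤ x) (hx1 : x < 1) (hα : 0 ≤ α) (hαβ : α ≤ β)
    (hβ : β ≤ 1) : Int.fract (x - α) < β - α ↔ α ≤ x ∧ x < β := by
  by_cases hxa : α ≤ x
  · have hf : Int.fract (x - α) = x - α := Int.fract_eq_self.mpr ⟨by linarith, by linarith⟩
    rw [hf]
    constructor
    · intro h; exact ⟨hxa, by linarith⟩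
    · intro h; linarith [h.2]
  · rw [not_le] at hxa
    have hf : Int.fract (x - α) = x - α + 1 := by
      rw [← Int.fract_add_one]
      exact Int.fract_eq_self.mpr ⟨by linarith, by linarith⟩
    rw [hf]
    constructor
    · intro h; linarith
    · intro h; linarith [h.1]

/-! ### Lemma 4: equidistribution of the roots in windows -/

set_option maxHeartbeats 400000 in
/-- **Iwaniec 1978, Lemma 4 (corrected), relative form — PROVED from Lemma 6.**  For every
`ε > 0` there is `C ≥ 0` such that for `Q ≠ 0`, `q ≥ 1`, `d ∣ q`, `A ≥ 2`, any `B, μ, ω` and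
`0 ≤ α ≤ β ≤ 1`, the number `P(α, β)` of pairs `(m, Θ) ∈ lemma4Family q Q d μ ω A B` with
`α ≤ Θ/(mq) < β` satisfies
`|P(α, β) − (β − α) P(0, 1)| ≤ 4 P(0,1)/A^{1/4} + C d (∑_{l∣Q} ρ(lq)) (1 + log(16A))² S^{1/2+ε} S`,
`S = ⌊√(Bq)⌋`.  (The printed Lemma 4 states the count as
`(π/4)(β−α)(M₁−M) ρ(q/d) A(q)/φ(d) + O((qM)^{3/4+ε})`, with a main term too large by `π²/6`,
see `IwaniecAlmostPrimes.lean`; the present relative form — equidistribution against the total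
count `P(0,1) = ρ(q/d) Σ`, `card_lemma4Family_eq` — is what the dispersion argument uses, the
total being evaluated by `abs_rhoSumAP_sub_le`.)  Proof: the Fejér-kernel form of Erdős–Turán
(`FejerCounting.card_filter_fract_lt_le`, `le_card_filter_fract_lt`) with `H = ⌊√A⌋ + 15`,
`δ = (H+1)^{-1/2}`, `norm_rootExpSum_le` for the exponential sums, and
`∑_{h ≤ H} τ(h)/h ≤ (1 + log H)²`. [cite: IwaniecInventiones1978, Lemma 4] -/
theorem lemma4_window (h6 : lemma6_hooley) {ε : ℝ} (hε : 0 < ε) :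
    ∃ C : ℝ, 0 ≤ C ∧ ∀ (q Q d μ ω A B : ℕ) (α β : ℝ), Q ≠ 0 → 0 < q → d ∣ q → 2 ≤ A →
      0 ≤ α → α ≤ β → β ≤ 1 →
      |(((lemma4Family q Q d μ ω A B).filter (fun p : ℕ × ℕ =>
            α ≤ (p.2 : ℝ) / (p.1 * q) ∧ (p.2 : ℝ) / (p.1 * q) < β)).card : ℝ) -
          (β - α) * (lemma4Family q Q d μ ω A B).card| ≤
        4 * (lemma4Family q Q d μ ω A B).card / (A : ℝ) ^ (1 / 4 : ℝ) +
          C * d * (∑ l ∈ Q.divisors, (rho (l * q) : ℝ)) * (1 + Real.log (16 * A)) ^ 2 *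
            ((Nat.sqrt (B * q) : ℝ) ^ (1 / 2 + ε) * Nat.sqrt (B * q)) := by
  obtain ⟨C, hC0, hC⟩ := norm_rootExpSum_le h6 hε
  refine ⟨2 * C * (3 + 8 * Real.pi * 16), by positivity, ?_⟩
  intro q Q d μ ω A B α β hQ hq hdq hA hα hαβ hβ
  set fam := lemma4Family q Q d μ ω A B with hfam
  set x : ℕ × ℕ → ℝ := fun p => (p.2 : ℝ) / (p.1 * q) with hx
  set H : ℕ := Nat.sqrt A + 15 with hH
  set R : ℝ := ∑ l ∈ Q.divisors, (rho (l * q) : ℝ) with hR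
  set P : ℝ := (Nat.sqrt (B * q) : ℝ) ^ (1 / 2 + ε) * Nat.sqrt (B * q) with hP
  have hd : 0 < d := Nat.pos_of_dvd_of_pos hdq hq
  have hA0 : (0 : ℝ) < A := by exact_mod_cast (by omega : 0 < A)
  have hR0 : 0 ≤ R := Finset.sum_nonneg fun _ _ => Nat.cast_nonneg _
  have hP0 : 0 ≤ P := by rw [hP]; positivity
  clear_value R P
  -- the window is a condition on a fractional part
  have hwindow : fam.filter (fun p : ℕ × ℕ =>
        α ≤ (p.2 : ℝ) / (p.1 * q) ∧ (p.2 : ℝ) / (p.1 * q) < β) =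
      fam.filter (fun p => Int.fract (x p - α) < β - α) := by
    refine Finset.filter_congr fun p hp => ?_
    rw [hfam, mem_lemma4Family, mem_rootsNat] at hp
    have hm0 : (0 : ℝ) < p.1 * q := by
      have : 0 < p.1 := by omega
      positivity
    have hx0 : 0 ≤ x p := by rw [hx]; positivity
    have hx1 : x p < 1 := by
      rw [hx]; dsimp only
      rw [div_lt_one hm0]; exact_mod_cast hp.2.2.2.1.1
    rw [fract_sub_lt_iff hx0 hx1 hα hαβ hβ]
  -- Fejér counting with `δ = (H+1)^{-1/2}`
  have hH16 : (16 : ℝ) ≤ H + 1 := by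
    have : (16 : ℕ) ≤ H + 1 := by rw [hH]; omega
    exact_mod_cast this
  have hH1pos : (0 : ℝ) < H + 1 := by linarith
  set σ : ℝ := Real.sqrt (H + 1) with hσ
  have hsq : σ ^ 2 = H + 1 := Real.sq_sqrt hH1pos.le
  have hσ4 : 4 ≤ σ := by
    rw [hσ, show (4 : ℝ) = Real.sqrt 16 by
      rw [show (16 : ℝ) = 4 ^ 2 by norm_num, Real.sqrt_sq (by norm_num)]]
    exact Real.sqrt_le_sqrt hH16
  have hσpos : 0 < σ := by linarith
  set δ : ℝ := 1 / σ with hδ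
  have hδpos : 0 < δ := by rw [hδ]; positivity
  have hδ4 : δ ≤ 1 / 4 := by rw [hδ]; exact one_div_le_one_div_of_le (by norm_num) hσ4
  have hHδ : ((H : ℝ) + 1) * δ = σ := by
    rw [hδ, ← hsq]; field_simp
  have hHδ1 : 1 ≤ ((H : ℝ) + 1) * δ := by rw [hHδ]; linarith
  have hup := FejerCounting.card_filter_fract_lt_le (H := H) fam x hαβ (by linarith) hδpos hδ4 hHδ1
  have hlo := FejerCounting.le_card_filter_fract_lt (H := H) fam x (α := α) (β := β)
    (by linarith) hδpos (by linarith)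
  rw [← hwindow] at hup hlo
  -- the exponential sums
  set E : ℝ := ∑ dd ∈ (Finset.Icc (-(H : ℤ)) H).erase 0,
    ‖∑ i ∈ fam, (𝐞 ((dd : ℝ) * x i) : ℂ)‖ / |(dd : ℝ)| with hE
  have hEbound : E ≤ 2 * C * (3 + 8 * Real.pi * 16) * d * R * (1 + Real.log (16 * A)) ^ 2 * P := by
    have hterm : ∀ dd ∈ (Finset.Icc (-(H : ℤ)) H).erase 0,
        ‖∑ i ∈ fam, (𝐞 ((dd : ℝ) * x i) : ℂ)‖ / |(dd : ℝ)| ≤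
          C * d * R * (3 + 8 * Real.pi * 16) * P *
            (((dd.natAbs).divisors.card : ℝ) / dd.natAbs) := by
      intro dd hdd
      rw [Finset.mem_erase, Finset.mem_Icc] at hdd
      have hdd0 : dd ≠ 0 := hdd.1
      have habs : |(dd : ℝ)| = (dd.natAbs : ℝ) := by
        rw [Nat.cast_natAbs, Int.cast_abs]
      have habs0 : 0 < (dd.natAbs : ℝ) := by exact_mod_cast Int.natAbs_pos.mpr hdd0
      have hsum : ∑ i ∈ fam, (𝐞 ((dd : ℝ) * x i) : ℂ) =
          ∑ p ∈ lemma4Family q Q d μ ω A B, (𝐞 ((dd : ℝ) * p.2 / (p.1 * q)) : ℂ) := by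
        refine Finset.sum_congr rfl fun p _ => ?_
        rw [hx]; dsimp only; rw [mul_div_assoc]
      have hmain := hC q Q d μ ω A B dd hQ hq hdq hA hdd0
      rw [← hsum, ← hR, ← hP] at hmain
      -- `|dd| ≤ H ≤ 16 A ≤ 16 A q`
      have hfrac : 3 + 8 * Real.pi * |(dd : ℝ)| / (A * q) ≤ 3 + 8 * Real.pi * 16 := by
        have hq1 : (1 : ℝ) ≤ q := by exact_mod_cast hq
        have hddH : |(dd : ℝ)| ≤ H := by
          rw [habs]
          have : dd.natAbs ≤ H := by omega
          exact_mod_cast this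
        have hHA : (H : ℝ) ≤ 16 * A := by
          have : H ≤ 16 * A := by
            rw [hH]; have := Nat.sqrt_le_self A; omega
          exact_mod_cast this
        have hAq : (A : ℝ) ≤ (A : ℝ) * q := by
          have := mul_le_mul_of_nonneg_left hq1 hA0.le; simpa using this
        have h1 : |(dd : ℝ)| / (A * q) ≤ 16 := by
          rw [div_le_iff₀ (by positivity)]
          calc |(dd : ℝ)| ≤ H := hddH
            _ ≤ 16 * A := hHA
            _ ≤ 16 * (A * q) := by linarith
        have h2 : 8 * Real.pi * |(dd : ℝ)| / (A * q) = 8 * Real.pi * (|(dd : ℝ)| / (A * q)) := by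
          ring
        rw [h2]
        have := mul_le_mul_of_nonneg_left h1 (by positivity : 0 ≤ 8 * Real.pi)
        linarith
      have hτ0 : (0 : ℝ) ≤ ((dd.natAbs).divisors.card : ℝ) := Nat.cast_nonneg _
      have hnum : C * d * R * ((dd.natAbs).divisors.card : ℝ) *
          (3 + 8 * Real.pi * |(dd : ℝ)| / (A * q)) * P ≤
          C * d * R * ((dd.natAbs).divisors.card : ℝ) * (3 + 8 * Real.pi * 16) * P := by
        have h0 : 0 ≤ C * d * R * ((dd.natAbs).divisors.card : ℝ) := by positivity
        exact mul_le_mul_of_nonneg_right (mul_le_mul_of_nonneg_left hfrac h0) hP0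
      rw [habs, div_le_iff₀ habs0]
      refine (hmain.trans hnum).trans (le_of_eq ?_)
      rw [mul_assoc (C * d * R * (3 + 8 * Real.pi * 16) * P), div_mul_cancel₀ _ habs0.ne']
      ring
    calc E ≤ ∑ dd ∈ (Finset.Icc (-(H : ℤ)) H).erase 0,
          C * d * R * (3 + 8 * Real.pi * 16) * P * (((dd.natAbs).divisors.card : ℝ) / dd.natAbs) :=
          Finset.sum_le_sum hterm
      _ = C * d * R * (3 + 8 * Real.pi * 16) * P *
            ∑ dd ∈ (Finset.Icc (-(H : ℤ)) H).erase 0,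
              (((dd.natAbs).divisors.card : ℝ) / dd.natAbs) := by
          rw [Finset.mul_sum]
      _ = C * d * R * (3 + 8 * Real.pi * 16) * P *
            (2 * ∑ h ∈ Finset.Icc 1 H, ((Nat.divisors h).card : ℝ) / h) := by
          congr 1
          rw [sum_Icc_erase_zero_eq_two_mul
            (fun dd : ℤ => ((dd.natAbs).divisors.card : ℝ) / dd.natAbs) (fun dd => by simp)]
          simp
      _ ≤ C * d * R * (3 + 8 * Real.pi * 16) * P * (2 * (1 + Real.log (16 * A)) ^ 2) := by
          have hH1 : 1 ≤ H := by rw [hH]; omega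
          have h1 := sum_card_divisors_div_le hH1
          have hlog : Real.log H ≤ Real.log (16 * A) := by
            refine Real.log_le_log (by exact_mod_cast (by omega : 0 < H)) ?_
            have : H ≤ 16 * A := by rw [hH]; have := Nat.sqrt_le_self A; omega
            exact_mod_cast this
          have hlog0 : 0 ≤ 1 + Real.log H := by
            have := Real.log_nonneg (by exact_mod_cast hH1 : (1 : ℝ) ≤ H); linarith
          have h2 : (1 + Real.log H) ^ 2 ≤ (1 + Real.log (16 * A)) ^ 2 := by
            apply pow_le_pow_left₀ hlog0; linarith
          have hc : 0 ≤ C * d * R * (3 + 8 * Real.pi * 16) * P := by positivity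
          exact mul_le_mul_of_nonneg_left (by linarith) hc
      _ = 2 * C * (3 + 8 * Real.pi * 16) * d * R * (1 + Real.log (16 * A)) ^ 2 * P := by ring
  -- `√(H+1) ≥ A^{1/4}`
  have hroot : (A : ℝ) ^ (1 / 4 : ℝ) ≤ σ := by
    have h1 : Real.sqrt A ≤ (H : ℝ) + 1 := by
      have := Real.real_sqrt_le_nat_sqrt_succ (a := A)
      have h' : ((Nat.sqrt A : ℕ) : ℝ) + 1 ≤ (H : ℝ) + 1 := by
        have : Nat.sqrt A ≤ H := by rw [hH]; omega
        have : ((Nat.sqrt A : ℕ) : ℝ) ≤ H := by exact_mod_cast this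
        linarith
      linarith
    have h2 : (A : ℝ) ^ (1 / 4 : ℝ) = Real.sqrt (Real.sqrt A) := by
      rw [Real.sqrt_eq_rpow, Real.sqrt_eq_rpow, ← Real.rpow_mul hA0.le]
      norm_num
    rw [h2, hσ]
    exact Real.sqrt_le_sqrt h1
  have hA4 : 0 < (A : ℝ) ^ (1 / 4 : ℝ) := Real.rpow_pos_of_pos hA0 _
  -- assembly
  set N : ℝ := (fam.card : ℝ) with hN
  have hN0 : 0 ≤ N := Nat.cast_nonneg _
  have hδN : 2 * δ * N = 2 * (N / σ) := by rw [hδ]; ring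
  have hHδN : 2 * N / ((H + 1) * δ) = 2 * (N / σ) := by rw [hHδ]; ring
  have hHδN' : N / ((H + 1) * δ) = N / σ := by rw [hHδ]
  rw [hδN, hHδN] at hup
  rw [hδN, hHδN'] at hlo
  have hNσ : N / σ ≤ N / (A : ℝ) ^ (1 / 4 : ℝ) := div_le_div_of_nonneg_left hN0 hA4 hroot
  have hNσ0 : 0 ≤ N / σ := by positivity
  have key : 4 * N / (A : ℝ) ^ (1 / 4 : ℝ) = 4 * (N / (A : ℝ) ^ (1 / 4 : ℝ)) := mul_div_assoc _ _ _
  rw [key, abs_le]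
  constructor
  · linarith [hlo, hEbound, hNσ, hNσ0]
  · linarith [hup, hEbound, hNσ, hNσ0]

/-! ### The total count: `#family = ρ(q/d) · (Σ(B) − Σ(A))` -/

/-- **Roots with a prescribed residue**: for `n d` coprime, `ω² + 1 ≡ 0 (mod d)`,
`#{0 ≤ Θ < nd : nd ∣ Θ² + 1, Θ ≡ ω (mod d)} = ρ(n)` (Chinese remainder theorem). [folklore] -/
theorem card_rootsNat_filter_modEq {n d ω : ℕ} (hn : 0 < n) (hd : 0 < d) (hnd : n.Coprime d)
    (hω : d ∣ ω ^ 2 + 1) :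
    ((rootsNat (n * d)).filter (fun Θ => Θ ≡ ω [MOD d])).card = rho n := by
  rw [← card_rootsNat n]
  -- `Θ ↦ Θ mod n`
  refine Finset.card_bij (fun Θ _ => Θ % n) ?_ ?_ ?_
  · intro Θ hΘ
    rw [Finset.mem_filter, mem_rootsNat] at hΘ
    rw [mem_rootsNat]
    refine ⟨Nat.mod_lt _ hn, ?_⟩
    have h1 : n ∣ Θ ^ 2 + 1 := (dvd_mul_right n d).trans hΘ.1.2
    have h2 : (Θ % n) ^ 2 + 1 ≡ Θ ^ 2 + 1 [MOD n] := ((Nat.mod_modEq Θ n).pow 2).add_right 1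
    exact (Nat.modEq_zero_iff_dvd.mp (h2.trans (Nat.modEq_zero_iff_dvd.mpr h1)))
  · intro a ha b hb hab
    rw [Finset.mem_filter, mem_rootsNat] at ha hb
    have h1 : a ≡ b [MOD n] := hab
    have h2 : a ≡ b [MOD d] := ha.2.trans hb.2.symm
    have h3 : a ≡ b [MOD n * d] := (Nat.modEq_and_modEq_iff_modEq_mul hnd).mp ⟨h1, h2⟩
    exact Nat.ModEq.eq_of_lt_of_lt h3 ha.1.1 hb.1.1
  · intro θ hθ
    rw [mem_rootsNat] at hθ
    obtain ⟨Θ, hΘn, hΘd⟩ := Nat.chineseRemainder hnd θ ω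
    have hmod : Θ % (n * d) ≡ Θ [MOD n * d] := Nat.mod_modEq Θ (n * d)
    refine ⟨Θ % (n * d), ?_, ?_⟩
    · rw [Finset.mem_filter, mem_rootsNat]
      refine ⟨⟨Nat.mod_lt _ (Nat.mul_pos hn hd), ?_⟩, ?_⟩
      · -- root modulo `n` and modulo `d`, hence modulo `nd`
        have hsq : (Θ % (n * d)) ^ 2 + 1 ≡ Θ ^ 2 + 1 [MOD n * d] := (hmod.pow 2).add_right 1
        refine (Nat.modEq_zero_iff_dvd.mp (hsq.trans ?_))
        refine (Nat.modEq_and_modEq_iff_modEq_mul hnd).mp ⟨?_, ?_⟩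
        · have e : Θ ^ 2 + 1 ≡ θ ^ 2 + 1 [MOD n] := (hΘn.pow 2).add_right 1
          exact e.trans (Nat.modEq_zero_iff_dvd.mpr hθ.2)
        · have e : Θ ^ 2 + 1 ≡ ω ^ 2 + 1 [MOD d] := (hΘd.pow 2).add_right 1
          exact e.trans (Nat.modEq_zero_iff_dvd.mpr hω)
      · exact (Nat.ModEq.of_mul_left n hmod).trans hΘd
    · have e : Θ % (n * d) ≡ θ [MOD n] := (Nat.ModEq.of_mul_right d hmod).trans hΘn
      rw [Nat.ModEq] at e
      rw [e, Nat.mod_eq_of_lt hθ.1]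

/-- The family as an iterated sum over `m` and then `Θ` (coprimality version). [folklore] -/
theorem card_lemma4Family_eq_sum (q Q d μ ω A B : ℕ) :
    (lemma4Family q Q d μ ω A B).card =
      ∑ m ∈ (Finset.Ioc A B).filter (fun m => m.Coprime Q ∧ m ≡ μ [MOD d]),
        ((rootsNat (m * q)).filter (fun Θ => Θ ≡ ω [MOD d])).card := by
  classical
  set fam := lemma4Family q Q d μ ω A B with hfam
  set Mset := (Finset.Ioc A B).filter (fun m => m.Coprime Q ∧ m ≡ μ [MOD d]) with hMset
  have hmaps : ∀ p ∈ fam, p.1 ∈ Mset := by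
    intro p hp
    rw [hfam, mem_lemma4Family] at hp
    rw [hMset, Finset.mem_filter, Finset.mem_Ioc]
    exact ⟨hp.1, hp.2.1, hp.2.2.1⟩
  rw [Finset.card_eq_sum_card_fiberwise hmaps]
  refine Finset.sum_congr rfl fun m hm => ?_
  rw [hMset, Finset.mem_filter, Finset.mem_Ioc] at hm
  refine Finset.card_bij (fun p _ => p.2) ?_ ?_ ?_
  · intro p hp
    rw [Finset.mem_filter, hfam, mem_lemma4Family] at hp
    obtain ⟨⟨-, -, -, h4, h5⟩, rfl⟩ := hp
    exact Finset.mem_filter.mpr ⟨h4, h5⟩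
  · intro a ha b hb hab
    rw [Finset.mem_filter] at ha hb
    exact Prod.ext (ha.2.trans hb.2.symm) hab
  · intro Θ hΘ
    rw [Finset.mem_filter] at hΘ
    refine ⟨(m, Θ), ?_, rfl⟩
    rw [Finset.mem_filter, hfam, mem_lemma4Family]
    exact ⟨⟨hm.1, hm.2.1, hm.2.2, hΘ.1, hΘ.2⟩, rfl⟩

/-- **The total count of the family**: for `Q` squarefree, `q ∣ Q`, `d ∣ q`, `ω` a root mod `d`
and `A ≤ B`:  `#lemma4Family q Q d μ ω A B = ρ(q/d) (Σ₀(B; Q, d, μ) − Σ₀(A; Q, d, μ))`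
(`Σ₀ = rhoSumAP`; for `(m, q) = 1` the roots mod `mq` in the class of `ω` mod `d` number
`ρ(m q/d) = ρ(m) ρ(q/d)`). [cite: IwaniecInventiones1978, Lemma 4] -/
theorem card_lemma4Family_eq {q Q d μ ω A B : ℕ} (hQ : Squarefree Q) (hqQ : q ∣ Q) (hdq : d ∣ q)
    (hω : d ∣ ω ^ 2 + 1) (hAB : A ≤ B) :
    ((lemma4Family q Q d μ ω A B).card : ℝ) =
      (rho (q / d) : ℝ) * ((rhoSumAP B Q d μ : ℝ) - (rhoSumAP A Q d μ : ℝ)) := by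
  classical
  have hQ0 : Q ≠ 0 := hQ.ne_zero
  have hq0 : 0 < q := Nat.pos_of_dvd_of_pos hqQ (Nat.pos_of_ne_zero hQ0)
  have hd0 : 0 < d := Nat.pos_of_dvd_of_pos hdq hq0
  have hqsf : Squarefree q := hQ.squarefree_of_dvd hqQ
  set q' := q / d with hq'
  have hqeq : q' * d = q := Nat.div_mul_cancel hdq
  have hq'0 : 0 < q' := by
    rcases Nat.eq_zero_or_pos q' with h | h
    · rw [h, zero_mul] at hqeq; omega
    · exact h
  have hq'd : q'.Coprime d := by
    have := hqsf; rw [← hqeq, Nat.squarefree_mul_iff] at this; exact this.1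
  set Mset := (Finset.Ioc A B).filter (fun m => m.Coprime Q ∧ m ≡ μ [MOD d]) with hMset
  -- each `m` contributes `ρ(m) ρ(q')`
  have hm : ∀ m ∈ Mset, ((rootsNat (m * q)).filter (fun Θ => Θ ≡ ω [MOD d])).card = rho m * rho q' := by
    intro m hm
    rw [hMset, Finset.mem_filter, Finset.mem_Ioc] at hm
    have hm0 : 0 < m := by omega
    have hmq : m.Coprime q := Nat.Coprime.coprime_dvd_right hqQ hm.2.1
    have hmq' : m.Coprime q' := Nat.Coprime.coprime_dvd_right (Dvd.intro d hqeq) hmq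
    have hmd : m.Coprime d := Nat.Coprime.coprime_dvd_right hdq hmq
    have hnd : (m * q').Coprime d := Nat.Coprime.mul_left hmd hq'd
    rw [show m * q = (m * q') * d by rw [← hqeq]; ring,
      card_rootsNat_filter_modEq (Nat.mul_pos hm0 hq'0) hd0 hnd hω,
      rho_mul_of_coprime hm0.ne' hq'0.ne' hmq']
  rw [card_lemma4Family_eq_sum, Finset.sum_congr rfl hm, ← Finset.sum_mul, Nat.cast_mul,
    Nat.cast_sum, mul_comm]
  congr 1
  -- `Σ₀(B) − Σ₀(A) = ∑_{A < m ≤ B} ρ(m)`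
  have hsplit : (Finset.Ioc 0 B).filter (fun m => m.Coprime Q ∧ m ≡ μ [MOD d]) =
      (Finset.Ioc 0 A).filter (fun m => m.Coprime Q ∧ m ≡ μ [MOD d]) ∪ Mset := by
    rw [hMset, ← Finset.filter_union, Finset.Ioc_union_Ioc_eq_Ioc (Nat.zero_le A) hAB]
  have hdisj : Disjoint ((Finset.Ioc 0 A).filter (fun m => m.Coprime Q ∧ m ≡ μ [MOD d])) Mset := by
    rw [hMset]
    refine Finset.disjoint_filter_filter (Finset.disjoint_left.mpr fun x hx hx' => ?_)
    rw [Finset.mem_Ioc] at hx hx'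
    omega
  rw [rhoSumAP, rhoSumAP, hsplit, Finset.sum_union hdisj]
  push_cast
  ring

end Literature.NumberTheory.Sieve.Iwaniec1978

end
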